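import Summits.Ventures.PercRepro.C026C028SeriesProbe

/-!
# The rows at a pendant mark (p6, gen 15; mine-3 MINE3-GLUING §2: the series edge at a mark)

If the mark `a` carries exactly one edge that is not surely closed, `f = {a, x}` of weight `s`, then
`a` reaches `m ≠ a` iff `f` is open and `x` reaches `m`, and the rows at `(a, b, c)` are affine images
of the rows at `(x, b, c)` on the deletion minor `p[f:=0]` (`rows_of_pendantMark`): `x_a = s·x`,
`y₁(a) = s·y₁`, `y₂(a) = s·y₂`, `y₃(a) = (x + y₃) − s·x`, `z(a) = (y₁ + y₂ + z) − s(y₁ + y₂)`.  With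
`rows_of_pendantProbe` this evaluates the one-vertex states of the forest-class bases.
-/

namespace PercRepro

namespace MultiGraph

variable {V E : Type*} (G : MultiGraph V E) [Fintype E] [DecidableEq E]

/-- A pendant mark reaches `m ≠ a` iff its edge `f` is open and the other end `x` reaches `m`. -/
theorem conn_mark_iff_of_pendant {p : E → ℝ} {f : E} {a x : V}
    (hax : (G.fst f = a ∧ G.snd f = x) ∨ (G.fst f = x ∧ G.snd f = a))
    (hpend : ∀ e', e' ≠ f → (G.fst e' = a ∨ G.snd e' = a) → p e' = 0)
    {ω : Config E} (hω : 0 < weight p ω) {m : V} (hm : m ≠ a) :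
    G.Conn ω a m ↔ ω f = true ∧ G.Conn ω x m :=
  G.conn_probe_iff_of_pendant hax hpend hω hm

/-- `P(b ↔ c)` does not see the pendant edge at `a`: it is `x + y₃` in the rows at `(x, b, c)` on the
deletion minor. -/
theorem prob_connEvent_eq_rows_of_pendantMark {p : E → ℝ} (hp : IsProb p) {f : E} {a x : V}
    (hax : (G.fst f = a ∧ G.snd f = x) ∨ (G.fst f = x ∧ G.snd f = a))
    (hpend : ∀ e', e' ≠ f → (G.fst e' = a ∨ G.snd e' = a) → p e' = 0) {b c : V}
    (hb : b ≠ a) (hc : c ≠ a) (hx : x ≠ a) :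
    prob p (G.connEvent b c) =
      G.law3 (Function.update p f 0) x b c 0 + G.law3 (Function.update p f 0) x b c 3 := by
  have hfa : G.fst f = a ∨ G.snd f = a := by
    rcases hax with ⟨h, _⟩ | ⟨_, h⟩
    · exact Or.inl h
    · exact Or.inr h
  have hrow := G.law3_update_one_eq_update_zero_of_pendant hp hfa hpend hx hb hc
  -- `P(b ↔ c) = x + y₃` at any weight vector, for the marks `(x, b, c)`
  have hrows : ∀ p' : E → ℝ, prob p' (G.connEvent b c) =
      G.law3 p' x b c 0 + G.law3 p' x b c 3 := by
    intro p'
    rw [law3_zero, law3_three, G.partitionEvent_row_abc, G.partitionEvent_row_bc_a]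
    have h := prob_inter_add_prob_inter_compl p' (G.connEvent b c) (G.connEvent x b)
    have e1 : G.connEvent b c ∩ G.connEvent x b = G.connEvent x b ∩ G.connEvent b c :=
      Set.inter_comm _ _
    have e2 : G.connEvent b c ∩ (G.connEvent x b)ᶜ = G.connEvent b c ∩ G.sepEvent x b := rfl
    rw [e1, e2] at h
    linarith
  rw [prob_split p f (G.connEvent b c), hrows, hrows, hrow 0, hrow 3]
  ring

/-- **The rows at a pendant mark** in terms of the rows at `(x, b, c)` on the deletion minor. -/
theorem rows_of_pendantMark {p : E → ℝ} (hp : IsProb p) {f : E} {a x : V}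
    (hax : (G.fst f = a ∧ G.snd f = x) ∨ (G.fst f = x ∧ G.snd f = a))
    (hpend : ∀ e', e' ≠ f → (G.fst e' = a ∨ G.snd e' = a) → p e' = 0) {b c : V}
    (hb : b ≠ a) (hc : c ≠ a) (hx : x ≠ a) :
    G.law3 p a b c 0 = p f * G.law3 (Function.update p f 0) x b c 0 ∧
      G.law3 p a b c 1 = p f * G.law3 (Function.update p f 0) x b c 1 ∧
      G.law3 p a b c 2 = p f * G.law3 (Function.update p f 0) x b c 2 ∧
      G.law3 p a b c 3 = (G.law3 (Function.update p f 0) x b c 0 +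
          G.law3 (Function.update p f 0) x b c 3) - p f * G.law3 (Function.update p f 0) x b c 0 ∧
      G.law3 p a b c 4 = (G.law3 (Function.update p f 0) x b c 1 +
          G.law3 (Function.update p f 0) x b c 2 + G.law3 (Function.update p f 0) x b c 4) -
        p f * (G.law3 (Function.update p f 0) x b c 1 + G.law3 (Function.update p f 0) x b c 2) := by
  have hfa : G.fst f = a ∨ G.snd f = a := by
    rcases hax with ⟨h, _⟩ | ⟨_, h⟩
    · exact Or.inl h
    · exact Or.inr h
  -- rows at the marks `(x, b, c)` do not see `f` (`a` pendant)
  have hrow := G.law3_update_one_eq_update_zero_of_pendant hp hfa hpend hx hb hc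
  -- the events «a ↔ m» against «f open ∧ x ↔ m»
  have key : ∀ (R : Set (Config E)) (m : V), m ≠ a →
      prob p (G.connEvent a m ∩ R) = prob p ((G.connEvent x m ∩ R) ∩ {ω | ω f = true}) := by
    intro R m hm
    refine prob_eq_of_eqOn_pos hp fun ω hω => ?_
    simp only [Set.mem_inter_iff, mem_connEvent, Set.mem_setOf_eq]
    rw [G.conn_mark_iff_of_pendant hax hpend hω hm]
    tauto
  refine ⟨?_, ?_, ?_, ?_, ?_⟩
  · rw [law3_zero, G.partitionEvent_row_abc, key _ b hb, prob_inter_open, ← G.partitionEvent_row_abc,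
      ← law3_zero, hrow 0]
  · rw [law3_one, G.partitionEvent_row_ab_c]
    have e : G.connEvent a b ∩ G.sepEvent a c = G.connEvent a b ∩ (G.connEvent a c)ᶜ := rfl
    have e' : G.connEvent x b ∩ G.sepEvent x c = G.connEvent x b ∩ (G.connEvent x c)ᶜ := rfl
    -- `a ↔ b ∧ a ↮ c` = `f open ∧ x ↔ b ∧ x ↮ c` on the support
    have h1 : prob p (G.connEvent a b ∩ G.sepEvent a c) =
        prob p ((G.connEvent x b ∩ G.sepEvent x c) ∩ {ω | ω f = true}) := by
      refine prob_eq_of_eqOn_pos hp fun ω hω => ?_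
      simp only [Set.mem_inter_iff, mem_connEvent, mem_sepEvent, Set.mem_setOf_eq]
      rw [G.conn_mark_iff_of_pendant hax hpend hω hb, G.conn_mark_iff_of_pendant hax hpend hω hc]
      tauto
    rw [h1, prob_inter_open, ← G.partitionEvent_row_ab_c, ← law3_one, hrow 1]
  · rw [law3_two, G.partitionEvent_row_ac_b]
    have h1 : prob p (G.connEvent a c ∩ G.sepEvent a b) =
        prob p ((G.connEvent x c ∩ G.sepEvent x b) ∩ {ω | ω f = true}) := by
      refine prob_eq_of_eqOn_pos hp fun ω hω => ?_
      simp only [Set.mem_inter_iff, mem_connEvent, mem_sepEvent, Set.mem_setOf_eq]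
      rw [G.conn_mark_iff_of_pendant hax hpend hω hb, G.conn_mark_iff_of_pendant hax hpend hω hc]
      tauto
    rw [h1, prob_inter_open, ← G.partitionEvent_row_ac_b, ← law3_two, hrow 2]
  · -- `P(b ↔ c ∧ a ↮ b) = P(b ↔ c) − P(b ↔ c ∧ a ↔ b)`
    rw [law3_three, G.partitionEvent_row_bc_a]
    have hsplit := prob_inter_add_prob_inter_compl p (G.connEvent b c) (G.connEvent a b)
    have hab : prob p (G.connEvent b c ∩ G.connEvent a b) =
        p f * G.law3 (Function.update p f 0) x b c 0 := by
      have e : G.connEvent b c ∩ G.connEvent a b = G.connEvent a b ∩ G.connEvent b c :=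
        Set.inter_comm _ _
      rw [e, key _ b hb, prob_inter_open, ← G.partitionEvent_row_abc, ← law3_zero, hrow 0]
    have e3 : G.connEvent b c ∩ (G.connEvent a b)ᶜ = G.connEvent b c ∩ G.sepEvent a b := rfl
    rw [e3] at hsplit
    rw [G.prob_connEvent_eq_rows_of_pendantMark hp hax hpend hb hc hx] at hsplit
    linarith
  · -- `P(a|b|c) = P(b ↮ c) − P(b ↮ c ∧ (a ↔ b ∨ a ↔ c))`
    rw [law3_four, G.partitionEvent_row_a_b_c]
    have hsplit := prob_inter_add_prob_inter_compl p (G.sepEvent b c)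
      (G.connEvent a b ∪ G.connEvent a c)
    have e1 : G.sepEvent b c ∩ (G.connEvent a b ∪ G.connEvent a c)ᶜ =
        G.sepEvent a b ∩ G.sepEvent a c ∩ G.sepEvent b c := by
      ext ω
      simp only [Set.mem_inter_iff, Set.mem_compl_iff, Set.mem_union, mem_connEvent, mem_sepEvent,
        not_or]
      tauto
    rw [e1] at hsplit
    -- `P_p(b ↮ c) = 1 − P_p(b ↔ c)` in the rows at `(x, b, c)` on the minor
    have hsep : prob p (G.sepEvent b c) =
        G.law3 (Function.update p f 0) x b c 1 + G.law3 (Function.update p f 0) x b c 2 +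
          G.law3 (Function.update p f 0) x b c 4 := by
      have hsum := law3_sum_eq_one G (Function.update p f 0) x b c
      have h := G.prob_connEvent_eq_rows_of_pendantMark hp hax hpend hb hc hx
      have hc' : prob p (G.sepEvent b c) = 1 - prob p (G.connEvent b c) := prob_compl _ _
      rw [hc', h]
      linarith
    -- `P(b ↮ c ∧ (a ↔ b ∨ a ↔ c)) = s·(y₁ + y₂)` at `(x, b, c)`
    have hmix : prob p (G.sepEvent b c ∩ (G.connEvent a b ∪ G.connEvent a c)) =
        p f * (G.law3 (Function.update p f 0) x b c 1 + G.law3 (Function.update p f 0) x b c 2) := by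
      have h1 : prob p (G.sepEvent b c ∩ (G.connEvent a b ∪ G.connEvent a c)) =
          prob p ((G.sepEvent b c ∩ (G.connEvent x b ∪ G.connEvent x c)) ∩ {ω | ω f = true}) := by
        refine prob_eq_of_eqOn_pos hp fun ω hω => ?_
        simp only [Set.mem_inter_iff, Set.mem_union, mem_connEvent, mem_sepEvent, Set.mem_setOf_eq]
        rw [G.conn_mark_iff_of_pendant hax hpend hω hb, G.conn_mark_iff_of_pendant hax hpend hω hc]
        tauto
      rw [h1, prob_inter_open]
      congr 1
      -- the disjoint union of the rows `ab|c` and `ac|b` at `(x, b, c)`, at any weight vector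
      have hE : ∀ p' : E → ℝ, prob p' (G.sepEvent b c ∩ (G.connEvent x b ∪ G.connEvent x c)) =
          G.law3 p' x b c 1 + G.law3 p' x b c 2 := by
        intro p'
        have h2 := prob_inter_add_prob_inter_compl p'
          (G.sepEvent b c ∩ (G.connEvent x b ∪ G.connEvent x c)) (G.connEvent x b)
        have e2 : G.sepEvent b c ∩ (G.connEvent x b ∪ G.connEvent x c) ∩ G.connEvent x b =
            G.connEvent x b ∩ G.sepEvent x c := by
          ext ω
          simp only [Set.mem_inter_iff, Set.mem_union, mem_connEvent, mem_sepEvent]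
          constructor
          · rintro ⟨⟨hbc, _⟩, hxb⟩
            exact ⟨hxb, fun h => hbc (hxb.symm.trans h)⟩
          · rintro ⟨hxb, hxc⟩
            exact ⟨⟨fun h => hxc (hxb.trans h), Or.inl hxb⟩, hxb⟩
        have e3 : G.sepEvent b c ∩ (G.connEvent x b ∪ G.connEvent x c) ∩ (G.connEvent x b)ᶜ =
            G.connEvent x c ∩ G.sepEvent x b := by
          ext ω
          simp only [Set.mem_inter_iff, Set.mem_union, Set.mem_compl_iff, mem_connEvent,
            mem_sepEvent]
          constructor
          · rintro ⟨⟨_, h⟩, hxb⟩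
            rcases h with h | h
            · exact absurd h hxb
            · exact ⟨h, hxb⟩
          · rintro ⟨hxc, hxb⟩
            exact ⟨⟨fun h => hxb (hxc.trans h.symm), Or.inr hxc⟩, hxb⟩
        rw [e2, e3] at h2
        rw [law3_one, law3_two, G.partitionEvent_row_ab_c, G.partitionEvent_row_ac_b]
        linarith
      rw [hE, hrow 1, hrow 2]
    rw [hmix, hsep] at hsplit
    linarith

/-! ### The trivial marking and the swap of the marks -/

/-- The rows at the marking `(v, v, v)`: `x = 1`, the rest `0`. -/
theorem law3_self (p : E → ℝ) (v : V) :
    G.law3 p v v v 0 = 1 ∧ G.law3 p v v v 1 = 0 ∧ G.law3 p v v v 2 = 0 ∧ G.law3 p v v v 3 = 0 ∧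
      G.law3 p v v v 4 = 0 := by
  have hU : G.connEvent v v = Set.univ := by
    ext ω; simp only [mem_connEvent, Set.mem_univ, iff_true]; exact Conn.refl G _ _
  have hE : G.sepEvent v v = ∅ := by
    ext ω; simp only [mem_sepEvent, Set.mem_empty_iff_false, iff_false, not_not]; exact Conn.refl G _ _
  refine ⟨?_, ?_, ?_, ?_, ?_⟩
  · rw [law3_zero, G.partitionEvent_row_abc, hU, Set.univ_inter, prob_univ]
  · rw [law3_one, G.partitionEvent_row_ab_c, hE, Set.inter_empty, prob_empty]
  · rw [law3_two, G.partitionEvent_row_ac_b, hE, Set.inter_empty, prob_empty]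
  · rw [law3_three, G.partitionEvent_row_bc_a, hE, Set.inter_empty, prob_empty]
  · rw [law3_four, G.partitionEvent_row_a_b_c, hE, Set.empty_inter, Set.empty_inter, prob_empty]

/-- Swapping the marks `a`, `b`: rows `abc`, `ab|c`, `a|b|c` are symmetric, `ac|b ↔ bc|a`. -/
theorem law3_swap_ab (p : E → ℝ) (a b c : V) :
    G.law3 p a b c 0 = G.law3 p b a c 0 ∧ G.law3 p a b c 1 = G.law3 p b a c 1 ∧
      G.law3 p a b c 2 = G.law3 p b a c 3 ∧ G.law3 p a b c 3 = G.law3 p b a c 2 ∧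
      G.law3 p a b c 4 = G.law3 p b a c 4 := by
  have hx : G.law3 p a b c 0 = G.law3 p b a c 0 := by
    rw [law3_zero, law3_zero, G.partitionEvent_row_abc, G.partitionEvent_row_abc]
    congr 1
    ext ω
    simp only [Set.mem_inter_iff, mem_connEvent]
    constructor
    · rintro ⟨hab, hbc⟩; exact ⟨hab.symm, hab.trans hbc⟩
    · rintro ⟨hba, hac⟩; exact ⟨hba.symm, hba.trans hac⟩
  have hA : G.law3 p a b c 0 + G.law3 p a b c 1 = G.law3 p b a c 0 + G.law3 p b a c 1 := by
    rw [G.law3_zero_add_one, G.law3_zero_add_one, G.connEvent_comm a b]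
  have h2 := G.law3_two_swap_ab p a b c
  have h3 := G.law3_two_swap_ab p b a c
  have hz : G.law3 p a b c 4 = G.law3 p b a c 4 := by
    rw [law3_four, law3_four, G.partitionEvent_row_a_b_c, G.partitionEvent_row_a_b_c]
    congr 1
    ext ω
    simp only [Set.mem_inter_iff, mem_sepEvent]
    constructor
    · rintro ⟨⟨hab, hac⟩, hbc⟩; exact ⟨⟨fun h => hab h.symm, hbc⟩, hac⟩
    · rintro ⟨⟨hba, hbc⟩, hac⟩; exact ⟨⟨fun h => hba h.symm, hac⟩, hbc⟩
  exact ⟨hx, by linarith, h2, h3.symm, hz⟩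

/-! ### The one-vertex copy -/

/-- **The one-vertex state**: a vertex `v` joined to the marks `a`, `b` by the edges `f₁ = {a, v}`
(weight `s₁`) and `f₂ = {b, v}` (weight `s₂`), these being the only non-closed edges at `a` and at `b`:
the rows at `(a, b, v)` are `(s₁s₂, 0, s₁(1 − s₂), s₂(1 − s₁), (1 − s₁)(1 − s₂))`. -/
theorem rows_oneVertex {p : E → ℝ} (hp : IsProb p) {f₁ f₂ : E} (hne : f₁ ≠ f₂) {a b v : V}
    (h₁ : (G.fst f₁ = a ∧ G.snd f₁ = v) ∨ (G.fst f₁ = v ∧ G.snd f₁ = a))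
    (h₂ : (G.fst f₂ = b ∧ G.snd f₂ = v) ∨ (G.fst f₂ = v ∧ G.snd f₂ = b))
    (hpa : ∀ e', e' ≠ f₁ → (G.fst e' = a ∨ G.snd e' = a) → p e' = 0)
    (hpb : ∀ e', e' ≠ f₂ → (G.fst e' = b ∨ G.snd e' = b) → p e' = 0)
    (hab : a ≠ b) (hav : a ≠ v) (hbv : b ≠ v) :
    G.law3 p a b v 0 = p f₁ * p f₂ ∧ G.law3 p a b v 1 = 0 ∧
      G.law3 p a b v 2 = p f₁ * (1 - p f₂) ∧ G.law3 p a b v 3 = p f₂ * (1 - p f₁) ∧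
      G.law3 p a b v 4 = (1 - p f₁) * (1 - p f₂) := by
  -- first the pendant mark `a`, with the rows at `(v, b, v)` on `p[f₁:=0]`
  obtain ⟨r0, r1, r2, r3, r4⟩ := G.rows_of_pendantMark hp h₁ hpa hab.symm hav.symm hav.symm
  -- the rows at `(v, b, v)` on `p[f₁:=0]`: swap to `(b, v, v)` and use the pendant mark `b`
  set p' := Function.update p f₁ 0 with hp'
  have hp'p : IsProb p' := hp.update f₁ ⟨le_rfl, zero_le_one⟩
  have hpb' : ∀ e', e' ≠ f₂ → (G.fst e' = b ∨ G.snd e' = b) → p' e' = 0 := by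
    intro e' he' hb'
    by_cases h : e' = f₁
    · rw [hp', h]; simp
    · rw [hp', Function.update_of_ne h]; exact hpb e' he' hb'
  obtain ⟨q0, q1, q2, q3, q4⟩ := G.rows_of_pendantMark hp'p h₂ hpb' hbv.symm hbv.symm hbv.symm
  obtain ⟨t0, t1, t2, t3, t4⟩ := G.law3_self (Function.update p' f₂ 0) v
  obtain ⟨w0, w1, w2, w3, w4⟩ := G.law3_swap_ab p' v b v
  have hf₂ : p' f₂ = p f₂ := by rw [hp', Function.update_of_ne hne.symm]
  simp only [t0, hf₂] at q0
  simp only [t1, hf₂] at q1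
  simp only [t2, hf₂] at q2
  simp only [t0, t3, hf₂] at q3
  simp only [t1, t2, t4, hf₂] at q4
  -- assemble
  refine ⟨?_, ?_, ?_, ?_, ?_⟩
  · rw [r0, w0, q0]; ring
  · rw [r1, w1, q1]; ring
  · rw [r2, w2, q3]; ring
  · rw [r3, w0, w3, q0, q2]; ring
  · rw [r4, w1, w2, w4, q1, q3, q4]; ring

end MultiGraph

end PercRepro
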